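import Literature.NumberTheory.Automorphic.Liu2021.AlbaneseBaseChangeFiniteGalois
import Literature.AlgebraicGeometry.Motives.AbelianVarietyBaseChangeSchemeMaps
import Literature.AlgebraicGeometry.Motives.FiberBaseChange
import HarnessLib

/-!
# Liu 2021, §2.1 / Lemma 2.4 — the `α`-compatible split of `Alb_X ⊗_k ℂ` by the complex Jacobians of the pieces (G4ℂ)

III-0 (G)-road, step G4ℂ (A-p18's carve; consumer: F6 `Lemma24OfJacobianDimension`).  From the finite-Galois split
`Albanese.exists_isGalois_isLimit_fan_baseChange_compat` (G4, over `L/k` finite Galois with `X_L = ∐ E_c`, `E_c(L) ≠ ∅`) we base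
change along an embedding `L → ℂ` over `k` and identify `(– ⊗_k L) ⊗_L ℂ ≅ – ⊗_k ℂ` by the PULLBACK-EXPLICIT object-level tower
isomorphism `Motives.baseChangeHomObjIsoOfComp (algebraMap k L) (algebraMap L ℂ) (algebraMap k ℂ) hτ` (the cell's spelling of
record, director g3 BATCH 104 (2); the functor-level `bcFunctorTowerIso` is kernel-toxic when unfolded).

Kernel design: everything is first proved for ABSTRACT identifications `eN, eX, eA` (of `∇X`, `X`, `Alb_X`) subject only to their
projection laws `e.hom.left ≫ pr₁ = pr₁ ≫ pr₁` (`exists_split_baseChange_complex_of_towerIsos`); the `incl`-clause is checked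
against the two projections `(pr_i)_ℂ : (X × X)_ℂ → X_ℂ` (`hom_ext_bcFunctor_tensor`), so NO monoidality (`μ`-square) of the tower
identification is needed, and the concrete isomorphisms are substituted once, at plain objects only.

References: Liu 2021 (arXiv:1208.5697v3, FJcycle.tex) §2.1 Proposition l. 1190–1200, Lemma 2.4 (1) l. 1220–1228;
Görtz–Wedhorn I, Prop. 4.16, §(4.7) (base change is functorial/transitive), Remark 16.54.
-/

open CategoryTheory CategoryTheory.Limits AlgebraicGeometry MonoidalCategory CartesianMonoidalCategory
open Literature.AlgebraicGeometry.Motives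
open AbelianVariety (bcSpec bcFunctor)
set_option backward.isDefEq.respectTransparency false

namespace Literature.NumberTheory.Automorphic.Liu2021.AppendixC

section TowerAbstract

variable {k L : Type} [Field k] [Field L] [Algebra k L] [Algebra L ℂ] [Algebra k ℂ]

/-- **Naturality from the projection laws.**  Two tower identifications `eV : (V ⊗_k L) ⊗_L ℂ ≅ V ⊗_k ℂ`,
`eW` which commute with the projections to `V`, `W` commute with every `m : V ⟶ W` (functoriality and transitivity of
base change). [cite: GortzWedhorn2020, Prop. 4.16 and §(4.7)] -/
theorem towerIso_naturality_of_fst {V W : SchemeOver k}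
    (eV : (bcFunctor L ℂ).obj ((bcFunctor k L).obj V) ≅ (bcFunctor k ℂ).obj V)
    (eW : (bcFunctor L ℂ).obj ((bcFunctor k L).obj W) ≅ (bcFunctor k ℂ).obj W)
    (hV : eV.hom.left ≫ pullback.fst V.hom (bcSpec k ℂ) =
      pullback.fst ((bcFunctor k L).obj V).hom (bcSpec L ℂ) ≫ pullback.fst V.hom (bcSpec k L))
    (hW : eW.hom.left ≫ pullback.fst W.hom (bcSpec k ℂ) =
      pullback.fst ((bcFunctor k L).obj W).hom (bcSpec L ℂ) ≫ pullback.fst W.hom (bcSpec k L))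
    (m : V ⟶ W) :
    eV.hom ≫ (bcFunctor k ℂ).map m = (bcFunctor L ℂ).map ((bcFunctor k L).map m) ≫ eW.hom := by
  ext
  apply pullback.hom_ext
  · rw [Over.comp_left, Over.comp_left, Category.assoc, Category.assoc, AbelianVariety.bcFunctor_map_left_fst,
      reassoc_of% hV, hW, AbelianVariety.bcFunctor_map_left_fst_assoc, AbelianVariety.bcFunctor_map_left_fst]
  · have h1 : (eV.hom ≫ (bcFunctor k ℂ).map m).left ≫ pullback.snd W.hom (bcSpec k ℂ) =
        pullback.snd ((bcFunctor k L).obj V).hom (bcSpec L ℂ) := Over.w _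
    have h2 : ((bcFunctor L ℂ).map ((bcFunctor k L).map m) ≫ eW.hom).left ≫ pullback.snd W.hom (bcSpec k ℂ) =
        pullback.snd ((bcFunctor k L).obj V).hom (bcSpec L ℂ) := Over.w _
    rw [h1, h2]

/-- **Morphisms into `(V × W) ⊗_K K′` are determined by their compositions with `(pr_V)_{K′}`, `(pr_W)_{K′}`** (and the
structure map) — the universal property of the fibre product `(V ×_K W) ×_K K′`. [cite: GortzWedhorn2020, Thm. 4.18 with Def. 4.9 and §(4.7)] -/
theorem hom_ext_bcFunctor_tensor {K K' : Type} [Field K] [Field K'] [Algebra K K'] {V W : SchemeOver K}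
    {Z : SchemeOver K'} (u v : Z ⟶ (bcFunctor K K').obj (V ⊗ W))
    (hf : u ≫ (bcFunctor K K').map (fst V W) = v ≫ (bcFunctor K K').map (fst V W))
    (hs : u ≫ (bcFunctor K K').map (snd V W) = v ≫ (bcFunctor K K').map (snd V W)) : u = v := by
  ext
  apply pullback.hom_ext
  · apply pullback.hom_ext
    · have h1 : pullback.fst (V ⊗ W).hom (bcSpec K K') ≫ pullback.fst V.hom W.hom =
          ((bcFunctor K K').map (fst V W)).left ≫ pullback.fst V.hom (bcSpec K K') := by
        rw [AbelianVariety.bcFunctor_map_left_fst, Over.fst_left]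
      rw [Category.assoc, Category.assoc, h1, ← Over.comp_left_assoc, ← Over.comp_left_assoc, hf]
    · have h1 : pullback.fst (V ⊗ W).hom (bcSpec K K') ≫ pullback.snd V.hom W.hom =
          ((bcFunctor K K').map (snd V W)).left ≫ pullback.fst W.hom (bcSpec K K') := by
        rw [AbelianVariety.bcFunctor_map_left_fst, Over.snd_left]
      rw [Category.assoc, Category.assoc, h1, ← Over.comp_left_assoc, ← Over.comp_left_assoc, hs]
  · have h1 : ∀ w : Z ⟶ (bcFunctor K K').obj (V ⊗ W), w.left ≫ pullback.snd (V ⊗ W).hom (bcSpec K K') = Z.hom :=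
      fun w => Over.w w
    rw [h1, h1]

open scoped MonObj in
/-- The tower identification of an abelian variety preserves the unit section (from its projection law: the unit of `A ⊗_k K′`
is the base change of the unit). [cite: GortzWedhorn2020, §(4.7) and Prop. 4.16] [cite: Milne1986AbelianVarieties, §2 Cor. 2.2 (PDF p. 170)] -/
theorem one_comp_towerIso_hom_of_fst (hτ : (algebraMap L ℂ).comp (algebraMap k L) = algebraMap k ℂ) (A : AbelianVariety k)
    (eA : (bcFunctor L ℂ).obj ((bcFunctor k L).obj A.X) ≅ (bcFunctor k ℂ).obj A.X)
    (hA : eA.hom.left ≫ pullback.fst A.X.hom (bcSpec k ℂ) =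
      pullback.fst ((bcFunctor k L).obj A.X).hom (bcSpec L ℂ) ≫ pullback.fst A.X.hom (bcSpec k L)) :
    η[((A.baseChange L).baseChange ℂ).X] ≫ eA.hom = η[(A.baseChange ℂ).X] := by
  have hsp : bcSpec L ℂ ≫ bcSpec k L = bcSpec k ℂ := by
    change Spec.map _ ≫ Spec.map _ = Spec.map _
    rw [← Spec.map_comp, ← CommRingCat.ofHom_comp, hτ]
  ext
  apply pullback.hom_ext
  · rw [Over.comp_left, Category.assoc, hA]
    erw [AbelianVariety.one_baseChange_left_comp_fst_assoc ℂ (A.baseChange L)]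
    rw [AbelianVariety.one_baseChange_left_comp_fst, ← Category.assoc, hsp]
    erw [AbelianVariety.one_baseChange_left_comp_fst ℂ A]
  · have h1 : (η[((A.baseChange L).baseChange ℂ).X] ≫ eA.hom).left ≫ pullback.snd A.X.hom (bcSpec k ℂ) = 𝟙 _ := Over.w _
    rw [h1, AbelianVariety.one_baseChange_left_comp_snd]

open scoped MonObj in
/-- **Transport of an `α`-compatible split along `L → ℂ`, abstract in the tower identifications** (kernel-friendly core):
given the `L`-level split `(π, i, l)` of `Alb_X ⊗_k L` with its biproduct identities and its `incl`- and `α`-compatibilities, and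
tower identifications `eN, eX, eA` of `∇X`, `X`, `Alb_X` along `k → L → ℂ` COMMUTING WITH THE PROJECTIONS, the base change along
`L → ℂ` (conjugated by the abelian-variety isomorphism over `eA`) is a split of `Alb_X ⊗_k ℂ` by the `J(E_c) ⊗_L ℂ`, with
`l_ℂ := μ ≫ (l_c)_ℂ ≫ eN` lying over `f_c × f_c` (`f_c := (e_c)_ℂ ≫ eX`) and carrying `(α_X)_ℂ` to `(diff_c)_ℂ ≫ i_c`.
[cite: Liu2021, §2.1 Proposition (FJcycle.tex l. 1190–1192) with proof (l. 1194–1200) and Lemma 2.4 (1) (proof, l. 1220–1228)] -/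
theorem exists_split_baseChange_complex_of_towerIsos (hτ : (algebraMap L ℂ).comp (algebraMap k L) = algebraMap k ℂ)
    {X : SchemeOver k} (a : Albanese X)
    {C : Type} [Fintype C] {E : C → SchemeOver L} (e : ∀ c, E c ⟶ (bcFunctor k L).obj X) (𝒥 : ∀ c, Jacobian (E c))
    (π : ∀ c, a.Alb.baseChange L ⟶ (𝒥 c).J) (i : ∀ c, (𝒥 c).J ⟶ a.Alb.baseChange L)
    (l : ∀ c, E c ⊗ E c ⟶ (bcFunctor k L).obj a.nabla.N)
    (hiπ : ∀ c, i c ≫ π c = 𝟙 _) (hiπ' : ∀ c c', c ≠ c' → i c ≫ π c' = 0) (htot : ∑ c, π c ≫ i c = 𝟙 _)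
    (hincl : ∀ c, l c ≫ (bcFunctor k L).map a.nabla.incl = (e c ⊗ₘ e c) ≫ Functor.LaxMonoidal.μ (bcFunctor k L) X X)
    (hα : ∀ c, l c ≫ (bcFunctor k L).map a.α = (𝒥 c).diff ≫ (i c).hom.hom.hom)
    (eN : (bcFunctor L ℂ).obj ((bcFunctor k L).obj a.nabla.N) ≅ (bcFunctor k ℂ).obj a.nabla.N)
    (eX : (bcFunctor L ℂ).obj ((bcFunctor k L).obj X) ≅ (bcFunctor k ℂ).obj X)
    (eA : (bcFunctor L ℂ).obj ((bcFunctor k L).obj a.Alb.X) ≅ (bcFunctor k ℂ).obj a.Alb.X)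
    (hN : eN.hom.left ≫ pullback.fst a.nabla.N.hom (bcSpec k ℂ) =
      pullback.fst ((bcFunctor k L).obj a.nabla.N).hom (bcSpec L ℂ) ≫ pullback.fst a.nabla.N.hom (bcSpec k L))
    (hX : eX.hom.left ≫ pullback.fst X.hom (bcSpec k ℂ) =
      pullback.fst ((bcFunctor k L).obj X).hom (bcSpec L ℂ) ≫ pullback.fst X.hom (bcSpec k L))
    (hA : eA.hom.left ≫ pullback.fst a.Alb.X.hom (bcSpec k ℂ) =
      pullback.fst ((bcFunctor k L).obj a.Alb.X).hom (bcSpec L ℂ) ≫ pullback.fst a.Alb.X.hom (bcSpec k L)) :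
    ∃ (πℂ : ∀ c, a.Alb.baseChange ℂ ⟶ ((𝒥 c).J).baseChange ℂ) (iℂ : ∀ c, ((𝒥 c).J).baseChange ℂ ⟶ a.Alb.baseChange ℂ)
      (lℂ : ∀ c, (bcFunctor L ℂ).obj (E c) ⊗ (bcFunctor L ℂ).obj (E c) ⟶ (bcFunctor k ℂ).obj a.nabla.N),
      (∀ c, iℂ c ≫ πℂ c = 𝟙 _) ∧ (∀ c c', c ≠ c' → iℂ c ≫ πℂ c' = 0) ∧ (∑ c, πℂ c ≫ iℂ c = 𝟙 _) ∧
      (∀ c, lℂ c ≫ (bcFunctor k ℂ).map a.nabla.incl =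
        (((bcFunctor L ℂ).map (e c) ≫ eX.hom) ⊗ₘ ((bcFunctor L ℂ).map (e c) ≫ eX.hom)) ≫
          Functor.LaxMonoidal.μ (bcFunctor k ℂ) X X) ∧
      (∀ c, lℂ c ≫ (bcFunctor k ℂ).map a.α =
        Functor.LaxMonoidal.μ (bcFunctor L ℂ) (E c) (E c) ≫ (bcFunctor L ℂ).map (𝒥 c).diff ≫ (iℂ c).hom.hom.hom) := by
  let G := AbelianVariety.baseChangeFunctor L ℂ
  have h4 := one_comp_towerIso_hom_of_fst hτ a.Alb eA hA
  let ε : (a.Alb.baseChange L).baseChange ℂ ≅ a.Alb.baseChange ℂ := AbelianVariety.isoOfOverIso eA h4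
  have hG : ∀ {A B : AbelianVariety L} (f : A ⟶ B), (G.map f).hom.hom.hom = (bcFunctor L ℂ).map f.hom.hom.hom := fun f =>
    AbelianVariety.Hom.baseChange_hom_hom_hom ℂ f
  have hε : ε.hom.hom.hom.hom = eA.hom :=
    AbelianVariety.isoOfOverIso_hom (B := (a.Alb.baseChange L).baseChange ℂ) (C := a.Alb.baseChange ℂ) eA h4
  have htotℂ : ∑ c, G.map (π c) ≫ G.map (i c) = 𝟙 (G.obj (a.Alb.baseChange L)) := by
    have h := congrArg G.map htot
    rw [G.map_sum, G.map_id] at h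
    simpa only [G.map_comp] using h
  -- naturality of the identifications at `incl ≫ pr₁`, `incl ≫ pr₂` and `α`
  have hnat1 := towerIso_naturality_of_fst eN eX hN hX (a.nabla.incl ≫ fst X X)
  have hnat2 := towerIso_naturality_of_fst eN eX hN hX (a.nabla.incl ≫ snd X X)
  have hnatα := towerIso_naturality_of_fst eN eA hN hA a.α
  -- the `L`-level split read against the projections: `l ≫ incl_L ≫ pr = pr ≫ e_c`
  have hl1 : ∀ c, l c ≫ (bcFunctor k L).map (a.nabla.incl ≫ fst X X) = fst _ _ ≫ e c := fun c => by
    rw [Functor.map_comp, ← Category.assoc, hincl c, Category.assoc, Functor.Monoidal.μ_fst, tensorHom_fst]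
  refine ⟨fun c => ε.inv ≫ G.map (π c), fun c => G.map (i c) ≫ ε.hom,
    fun c => Functor.LaxMonoidal.μ (bcFunctor L ℂ) (E c) (E c) ≫ (bcFunctor L ℂ).map (l c) ≫ eN.hom, ?_, ?_, ?_, ?_, ?_⟩
  · intro c
    rw [Category.assoc, ε.hom_inv_id_assoc, ← G.map_comp, hiπ, G.map_id]
    rfl
  · intro c c' h
    rw [Category.assoc, ε.hom_inv_id_assoc, ← G.map_comp, hiπ' c c' h, G.map_zero]
  · have hre : ∀ c, (ε.inv ≫ G.map (π c)) ≫ (G.map (i c) ≫ ε.hom) = ε.inv ≫ ((G.map (π c) ≫ G.map (i c)) ≫ ε.hom) :=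
      fun c => by simp only [Category.assoc]
    change ∑ c, (ε.inv ≫ G.map (π c)) ≫ (G.map (i c) ≫ ε.hom) = 𝟙 _
    rw [Finset.sum_congr rfl fun c _ => hre c, ← Preadditive.comp_sum, ← Preadditive.sum_comp, htotℂ]
    erw [Category.id_comp]
    exact ε.inv_hom_id
  · intro c
    have hl2 : l c ≫ (bcFunctor k L).map (a.nabla.incl ≫ snd X X) = snd _ _ ≫ e c := by
      rw [Functor.map_comp, ← Category.assoc, hincl c, Category.assoc, Functor.Monoidal.μ_snd, tensorHom_snd]
    apply hom_ext_bcFunctor_tensor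
    · rw [Category.assoc, Category.assoc, Category.assoc, ← (bcFunctor k ℂ).map_comp, hnat1,
        ← (bcFunctor L ℂ).map_comp_assoc, hl1 c, (bcFunctor L ℂ).map_comp_assoc, Functor.Monoidal.μ_fst_assoc,
        Category.assoc, Functor.Monoidal.μ_fst, tensorHom_fst]
    · rw [Category.assoc, Category.assoc, Category.assoc, ← (bcFunctor k ℂ).map_comp, hnat2,
        ← (bcFunctor L ℂ).map_comp_assoc, hl2, (bcFunctor L ℂ).map_comp_assoc, Functor.Monoidal.μ_snd_assoc,
        Category.assoc, Functor.Monoidal.μ_snd, tensorHom_snd]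
  · intro c
    have hcomp : (G.map (i c) ≫ ε.hom).hom.hom.hom = (G.map (i c)).hom.hom.hom ≫ ε.hom.hom.hom.hom := rfl
    simp only [Category.assoc]
    rw [hnatα, ← (bcFunctor L ℂ).map_comp_assoc, hα c, (bcFunctor L ℂ).map_comp_assoc, hcomp, hG, hε]

end TowerAbstract

/-- Projection law of the pullback-explicit tower isomorphism (tree `baseChangeHomObjIsoOfComp_hom_left_fst`), `bcFunctor` spelling.
[cite: GortzWedhorn2020, Prop. 4.16 and §(4.7)] -/
theorem baseChangeHomObjIsoOfComp_hom_left_fst' {k L : Type} [Field k] [Field L] [Algebra k L] [Algebra L ℂ] [Algebra k ℂ]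
    (hτ : (algebraMap L ℂ).comp (algebraMap k L) = algebraMap k ℂ) (Y : SchemeOver k) :
    (baseChangeHomObjIsoOfComp (algebraMap k L) (algebraMap L ℂ) (algebraMap k ℂ) hτ Y).hom.left ≫
        pullback.fst Y.hom (bcSpec k ℂ) =
      pullback.fst ((bcFunctor k L).obj Y).hom (bcSpec L ℂ) ≫ pullback.fst Y.hom (bcSpec k L) :=
  baseChangeHomObjIsoOfComp_hom_left_fst (algebraMap k L) (algebraMap L ℂ) (algebraMap k ℂ) hτ Y

/-- **G4ℂ — the `α`-compatible split of `Alb_X ⊗_k ℂ` by the complex Albanese varieties of the pieces** (III-0 (G)-road; see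
the abstract core `exists_split_baseChange_complex_of_towerIsos` and `Albanese.exists_isGalois_isLimit_fan_baseChange_compat`).
The tower identification is the pullback-explicit `Motives.baseChangeHomObjIsoOfComp (algebraMap k L) (algebraMap L ℂ) (algebraMap k ℂ) hτ`
(A-p18's currency). [cite: Liu2021, §2.1 Proposition (FJcycle.tex l. 1190–1192) with proof (l. 1194–1200) and Lemma 2.4 (1) (proof, l. 1220–1228)]
[cite: GortzWedhorn2020, Prop. 4.16 and Remark 16.54] -/
theorem Albanese.exists_isGalois_split_baseChange_complex_compat {k : Type} [Field k] [CharZero k] [Algebra k ℂ]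
    {d : ℕ} (X : SchemeOver k) [SmoothOfRelativeDimension d X.hom] (hX : IsProjectiveOver X) (a : Albanese X) :
    ∃ (L : Type) (_ : Field L) (_ : Algebra k L) (_ : FiniteDimensional k L) (_ : IsGalois k L)
      (_ : Algebra L ℂ) (hτ : (algebraMap L ℂ).comp (algebraMap k L) = algebraMap k ℂ)
      (C : Type) (_ : Fintype C) (E : C → SchemeOver L) (e : ∀ c, E c ⟶ (bcFunctor k L).obj X)
      (_ : ∀ c, IsSmoothProjective d (E c)) (_ : Nonempty (IsColimit (Cofan.mk ((bcFunctor k L).obj X) e)))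
      (_ : ∀ c, AlgPoints (E c) L) (𝒥 : ∀ c, Jacobian (E c))
      (π : ∀ c, a.Alb.baseChange ℂ ⟶ ((𝒥 c).J).baseChange ℂ) (i : ∀ c, ((𝒥 c).J).baseChange ℂ ⟶ a.Alb.baseChange ℂ)
      (l : ∀ c, (bcFunctor L ℂ).obj (E c) ⊗ (bcFunctor L ℂ).obj (E c) ⟶ (bcFunctor k ℂ).obj a.nabla.N),
      (∀ c, i c ≫ π c = 𝟙 _) ∧ (∀ c c', c ≠ c' → i c ≫ π c' = 0) ∧ (∑ c, π c ≫ i c = 𝟙 _) ∧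
      (∀ c, l c ≫ (bcFunctor k ℂ).map a.nabla.incl =
        (((bcFunctor L ℂ).map (e c) ≫ (baseChangeHomObjIsoOfComp (algebraMap k L) (algebraMap L ℂ) (algebraMap k ℂ) hτ X).hom) ⊗ₘ
            ((bcFunctor L ℂ).map (e c) ≫ (baseChangeHomObjIsoOfComp (algebraMap k L) (algebraMap L ℂ) (algebraMap k ℂ) hτ X).hom)) ≫
          Functor.LaxMonoidal.μ (bcFunctor k ℂ) X X) ∧
      (∀ c, l c ≫ (bcFunctor k ℂ).map a.α =
        Functor.LaxMonoidal.μ (bcFunctor L ℂ) (E c) (E c) ≫ (bcFunctor L ℂ).map (𝒥 c).diff ≫ (i c).hom.hom.hom) := by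
  obtain ⟨L, _, _, _, _, C, _, E, e, hE, hcol, P, 𝒥, π, i, l, -, hiπ, hiπ', htot, hincl, hα⟩ :=
    Albanese.exists_isGalois_isLimit_fan_baseChange_compat (d := d) X hX a
  letI : Algebra L ℂ := ((IsAlgClosed.lift : L →ₐ[k] ℂ) : L →+* ℂ).toAlgebra
  have hτ : (algebraMap L ℂ).comp (algebraMap k L) = algebraMap k ℂ := (IsAlgClosed.lift : L →ₐ[k] ℂ).comp_algebraMap
  obtain ⟨πℂ, iℂ, lℂ, h1, h2, h3, h5, h6⟩ := exists_split_baseChange_complex_of_towerIsos hτ a e 𝒥 π i l hiπ hiπ' htot hincl hα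
    (baseChangeHomObjIsoOfComp (algebraMap k L) (algebraMap L ℂ) (algebraMap k ℂ) hτ a.nabla.N)
    (baseChangeHomObjIsoOfComp (algebraMap k L) (algebraMap L ℂ) (algebraMap k ℂ) hτ X)
    (baseChangeHomObjIsoOfComp (algebraMap k L) (algebraMap L ℂ) (algebraMap k ℂ) hτ a.Alb.X)
    (baseChangeHomObjIsoOfComp_hom_left_fst' hτ a.nabla.N) (baseChangeHomObjIsoOfComp_hom_left_fst' hτ X)
    (baseChangeHomObjIsoOfComp_hom_left_fst' hτ a.Alb.X)
  exact ⟨L, inferInstance, inferInstance, inferInstance, inferInstance, inferInstance, hτ, C, inferInstance, E, e, hE, hcol, P, 𝒥,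
    πℂ, iℂ, lℂ, h1, h2, h3, h5, h6⟩

/-- **G4ℂ, abstract-`eX` export** (kernel device for the F6 consumer, A-p17): the same split as
`Albanese.exists_isGalois_split_baseChange_complex_compat`, but the tower identification of `X` is returned as an OPAQUE
isomorphism `eX : (X ⊗_k L) ⊗_L ℂ ≅ X ⊗_k ℂ` of `bcFunctor`-typed objects together with (i) its projection law and (ii) the
equation `eX = baseChangeHomObjIsoOfComp …` — so that a consumer can run every diagram chase over the abstract `eX` (kernel-cheap)
and never instantiate a chase lemma at the concrete isomorphism (measured kernel-expensive, A-p10 work/F6/B5). [cite: Liu2021, §2.1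
Proposition (FJcycle.tex l. 1190–1192) with proof (l. 1194–1200) and Lemma 2.4 (1) (proof, l. 1220–1228)] [cite: GortzWedhorn2020, Prop. 4.16 and §(4.7)] -/
theorem Albanese.exists_isGalois_split_baseChange_complex_compat_abstract {k : Type} [Field k] [CharZero k] [Algebra k ℂ]
    {d : ℕ} (X : SchemeOver k) [SmoothOfRelativeDimension d X.hom] (hX : IsProjectiveOver X) (a : Albanese X) :
    ∃ (L : Type) (_ : Field L) (_ : Algebra k L) (_ : FiniteDimensional k L) (_ : IsGalois k L)
      (_ : Algebra L ℂ) (hτ : (algebraMap L ℂ).comp (algebraMap k L) = algebraMap k ℂ)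
      (eX : (bcFunctor L ℂ).obj ((bcFunctor k L).obj X) ≅ (bcFunctor k ℂ).obj X)
      (_ : eX.hom.left ≫ pullback.fst X.hom (bcSpec k ℂ) =
        pullback.fst ((bcFunctor k L).obj X).hom (bcSpec L ℂ) ≫ pullback.fst X.hom (bcSpec k L))
      (_ : eX = baseChangeHomObjIsoOfComp (algebraMap k L) (algebraMap L ℂ) (algebraMap k ℂ) hτ X)
      (C : Type) (_ : Fintype C) (E : C → SchemeOver L) (e : ∀ c, E c ⟶ (bcFunctor k L).obj X)
      (_ : ∀ c, IsSmoothProjective d (E c)) (_ : Nonempty (IsColimit (Cofan.mk ((bcFunctor k L).obj X) e)))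
      (_ : ∀ c, AlgPoints (E c) L) (𝒥 : ∀ c, Jacobian (E c))
      (π : ∀ c, a.Alb.baseChange ℂ ⟶ ((𝒥 c).J).baseChange ℂ) (i : ∀ c, ((𝒥 c).J).baseChange ℂ ⟶ a.Alb.baseChange ℂ)
      (l : ∀ c, (bcFunctor L ℂ).obj (E c) ⊗ (bcFunctor L ℂ).obj (E c) ⟶ (bcFunctor k ℂ).obj a.nabla.N),
      (∀ c, i c ≫ π c = 𝟙 _) ∧ (∀ c c', c ≠ c' → i c ≫ π c' = 0) ∧ (∑ c, π c ≫ i c = 𝟙 _) ∧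
      (∀ c, l c ≫ (bcFunctor k ℂ).map a.nabla.incl =
        (((bcFunctor L ℂ).map (e c) ≫ eX.hom) ⊗ₘ ((bcFunctor L ℂ).map (e c) ≫ eX.hom)) ≫
          Functor.LaxMonoidal.μ (bcFunctor k ℂ) X X) ∧
      (∀ c, l c ≫ (bcFunctor k ℂ).map a.α =
        Functor.LaxMonoidal.μ (bcFunctor L ℂ) (E c) (E c) ≫ (bcFunctor L ℂ).map (𝒥 c).diff ≫ (i c).hom.hom.hom) := by
  obtain ⟨L, _, _, _, _, C, _, E, e, hE, hcol, P, 𝒥, π, i, l, -, hiπ, hiπ', htot, hincl, hα⟩ :=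
    Albanese.exists_isGalois_isLimit_fan_baseChange_compat (d := d) X hX a
  letI : Algebra L ℂ := ((IsAlgClosed.lift : L →ₐ[k] ℂ) : L →+* ℂ).toAlgebra
  have hτ : (algebraMap L ℂ).comp (algebraMap k L) = algebraMap k ℂ := (IsAlgClosed.lift : L →ₐ[k] ℂ).comp_algebraMap
  obtain ⟨πℂ, iℂ, lℂ, h1, h2, h3, h5, h6⟩ := exists_split_baseChange_complex_of_towerIsos hτ a e 𝒥 π i l hiπ hiπ' htot hincl hα
    (baseChangeHomObjIsoOfComp (algebraMap k L) (algebraMap L ℂ) (algebraMap k ℂ) hτ a.nabla.N)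
    (baseChangeHomObjIsoOfComp (algebraMap k L) (algebraMap L ℂ) (algebraMap k ℂ) hτ X)
    (baseChangeHomObjIsoOfComp (algebraMap k L) (algebraMap L ℂ) (algebraMap k ℂ) hτ a.Alb.X)
    (baseChangeHomObjIsoOfComp_hom_left_fst' hτ a.nabla.N) (baseChangeHomObjIsoOfComp_hom_left_fst' hτ X)
    (baseChangeHomObjIsoOfComp_hom_left_fst' hτ a.Alb.X)
  exact ⟨L, inferInstance, inferInstance, inferInstance, inferInstance, inferInstance, hτ,
    baseChangeHomObjIsoOfComp (algebraMap k L) (algebraMap L ℂ) (algebraMap k ℂ) hτ X,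
    baseChangeHomObjIsoOfComp_hom_left_fst' hτ X, rfl, C, inferInstance, E, e, hE, hcol, P, 𝒥, πℂ, iℂ, lℂ, h1, h2, h3, h5, h6⟩

end Literature.NumberTheory.Automorphic.Liu2021.AppendixC
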